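import Summits.MatrixMultiplication.OmegaCensus.SmallFormats.MatMul22nGF3CountCertificatePlus
import Summits.MatrixMultiplication.OmegaCensus.SmallFormats.MatMul2210GF3Cap10CertificatePart0
import Summits.MatrixMultiplication.OmegaCensus.SmallFormats.MatMul2210GF3Cap10CertificatePart1
import Summits.MatrixMultiplication.OmegaCensus.SmallFormats.MatMul2210GF3Cap10CertificatePart2
import Summits.MatrixMultiplication.OmegaCensus.SmallFormats.MatMul2210GF3Cap10CertificatePart3
import Summits.MatrixMultiplication.OmegaCensus.SmallFormats.MatMul2210GF3Cap10CertificatePart4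
import Mathlib.Tactic.Linarith
import HarnessLib

/-!
# ω-census family (a): count certificate at `(10, 33)` with invertible-line cap `10` — main file (5 part files) (generated; tensor g35/g36 pipeline)

Cell `pub-omega` (unit `pub-omega-tensor`), topic `Summits/MatrixMultiplication/OmegaCensus` (sub-folder `SmallFormats`). Framing
(verbatim): lottery ticket; floor = certified bounds/negative ranges. HONEST FRAMING: a branch-and-bound / Farkas certificate
(999 nodes, 500 leaves; exact rational LP on kit, bundle kitjob-bbplus of tensor g36 = tensor g35's kit-j318794 pipeline) that NO count
vector over tensor g31's 40 classes satisfies the class-wise clauses of `XCaps3 10 33` with the invertible lines capped at 10 and total 33;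
each leaf is closed by `linarith` from the listed clause loads. The cap 10 is the HALF LAW PLUS ONE (`4·33 ≤ 11·10 + 2·10 + 2`, `2·33 < 7·10`;
pipeline `succ_le_tensorRank_22n_gf3_of_count_certificate'`, p682596). Nothing on `ω`.
-/

namespace Summit.MatrixMultiplication.OmegaCensus.SmallFormats.Enum723

open Finset

set_option maxHeartbeats 8000000 in
/-- **No count vector at `(10, 33)` with invertible cap `10`.** -/
theorem no_adm1033cap10 (c : ℕ → ℕ) (hJ : ∀ k, k < 32 → load c k + 3 * 10 ≤ 33)
    (hRC : ∀ k, 32 ≤ k → k < 40 → load c k + 6 * 10 ≤ 2 * 33) (hQ : ∀ k, 40 ≤ k → k < 58 → load c k + 3 * 10 ≤ 33)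
    (hL : ∀ k, 58 ≤ k → k < 82 → load c k ≤ 10) (ht : tot c = 33) : False := by
  rcases Nat.lt_or_ge (c 0) 1 with hub0_0 | hlb0_1
  · rcases Nat.lt_or_ge (c 14) 1 with hub14_0 | hlb14_1
    · rcases Nat.lt_or_ge (c 24) 2 with hub24_1 | hlb24_2
      · exact no_adm1033cap10_part0 c hJ hRC hQ hL ht hub0_0 hub14_0 hub24_1
      · exact no_adm1033cap10_part1 c hJ hRC hQ hL ht hub0_0 hub14_0 hlb24_2
    · exact no_adm1033cap10_part2 c hJ hRC hQ hL ht hub0_0 hlb14_1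
  · rcases Nat.lt_or_ge (c 2) 1 with hub2_0 | hlb2_1
    · exact no_adm1033cap10_part3 c hJ hRC hQ hL ht hlb0_1 hub2_0
    · exact no_adm1033cap10_part4 c hJ hRC hQ hL ht hlb0_1 hlb2_1

/-- **`34 ≤ R_𝔽₃(⟨2,2,10⟩)`** — the certificate through the pipeline-plus (the half law plus one caps the invertible lines at 10). -/
theorem thirtyfour_le_tensorRank_2210_gf3 : 34 ≤ Literature.Computability.AlgebraicComplexity.tensorRank
    (Literature.Computability.AlgebraicComplexity.matMulTensor (ZMod 3) 2 2 10) :=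
  thirtyfour_le_tensorRank_2210_gf3_of_count_certificate no_adm1033cap10

/-- The kernel window at `⟨2,2,10⟩` over `𝔽₃` after this file: `[34, 35]`. -/
theorem tensorRank_2210_gf3_window' : 34 ≤ Literature.Computability.AlgebraicComplexity.tensorRank
      (Literature.Computability.AlgebraicComplexity.matMulTensor (ZMod 3) 2 2 10) ∧
    Literature.Computability.AlgebraicComplexity.tensorRank (Literature.Computability.AlgebraicComplexity.matMulTensor (ZMod 3) 2 2 10) ≤ 35 :=
  ⟨thirtyfour_le_tensorRank_2210_gf3, by have h := (tensorRank_matMulTensor_22n_gf3_window 10 (by norm_num)).2; omega⟩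

end Summit.MatrixMultiplication.OmegaCensus.SmallFormats.Enum723
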